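import Summits.Ventures.Crystal3D.Theorems.StickyWulffConstantGenericWallFloorCubicCoords
import HarnessLib

/-!
# Second-moment isotropy of the twelve fcc bond vectors (`Σ_w ⟪w,a⟫⟪w,b⟫ = 4⟪a,b⟫`) and the exact lattice flux source

HONEST FRAMING. Part of the venture `Summits/Ventures/Crystal3D` (cell `crystal3d-full`), helper for the crux
`NoReconstructionGain` (stmt-Ventures-19144, route `route-Ventures-StickyWulffConstant`), line
`replication-exactness`, lead wulff-p1 g21; memo `HOME/wulff-p1/g21/VFLUX-g21.md` (the VORONOI FLUX
CALIBRATION: `2(D − X) = Σ_i [(12 − deg_i) − 2√3 V_{i,z}]`), crux idea card `voronoi-flux-calibration`.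

The one lattice input of every calibration / flux argument at a GENERAL normal `ν` is that the lattice
source sheet is exact: the bonds of `Λ₀ = fccStacking 1 √(2/3)` crossing a plane `⊥ ν`, weighted by
`⟪u, ν⟫`, add up to the vector `2ν` — equivalently the twelve bond vectors (`fccSlots`) form a
spherical 2-design up to scale:

* `sum_slotVec_dot_mul_dot` — in cubic coordinates `Σ_k (s_k·A)(s_k·B) = 4 (A·B)` (brute force);
* `sum_fccSlots_inner_mul_inner` — `Σ_{w ∈ fccSlots} ⟪w,a⟫⟪w,b⟫ = 4⟪a,b⟫`;
  (the diagonal case `Σ_w ⟪w,x⟫² = 4‖x‖²` is the tree's `sum_slots_inner_sq` of `…SlotFrameIdentity`,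
  proved there independently; this is its polarised/bilinear form, proved directly in cubic coordinates);
* `sum_fccSlots_inner_smul` — `Σ_w ⟪w,ν⟫ • w = 4 • ν`;
* `sum_fccSlots_posPart_inner_smul` — **the flux source** `Σ_w max ⟪w,ν⟫ 0 • w = 2 • ν`: summing
  `⟪u,ν⟫ u` over the bonds `u` pointing to the `ν`-side gives exactly `2ν`, for EVERY `ν` (so the
  midplane source of the flux identity equals `2⟪ν, y⟫·area` for any calibrating vector `y`, in
  particular `2φ(ν)` for `y` on the Wulff shape).

WHAT THIS IS NOT: nothing about films or the crux beyond this lattice identity; rung F-C1 not moved.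
-/

noncomputable section

namespace Summit.Ventures.Crystal3D.Theorems

open Summit.Ventures.Crystal3D Finset Matrix NearIdentity
open scoped InnerProductSpace

/-- **Isotropy in cubic coordinates**: for the twelve integer bond vectors `s_k ∈ {(±1,±1,0),…}/√2`,
`Σ_k (s_k · A)(s_k · B) = 4 (A · B)`. -/
theorem sum_slotVec_dot_mul_dot (A B : Fin 3 → ℝ) :
    ∑ k : Fin 12, (slotVec k ⬝ᵥ A) * (slotVec k ⬝ᵥ B) = 4 * (A ⬝ᵥ B) := by
  have h2 : Real.sqrt 2 ^ 2 = 2 := Real.sq_sqrt (by norm_num)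
  have hk : ∀ k : Fin 12, (slotVec k ⬝ᵥ A) * (slotVec k ⬝ᵥ B) =
      ((∑ i, (slotInt k i : ℝ) * A i) * (∑ i, (slotInt k i : ℝ) * B i)) / 2 := by
    intro k
    have hdot : ∀ C : Fin 3 → ℝ, slotVec k ⬝ᵥ C = (∑ i, (slotInt k i : ℝ) * C i) / Real.sqrt 2 := by
      intro C
      simp only [dotProduct, slotVec, Finset.sum_div]
      refine Finset.sum_congr rfl fun i _ => ?_
      ring
    rw [hdot A, hdot B, div_mul_div_comm, ← sq, h2]
  simp_rw [hk]
  rw [← Finset.sum_div]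
  simp [Fin.sum_univ_succ, slotInt, dotProduct]
  ring

/-- **Second-moment isotropy of the fcc bond vectors**: `Σ_{w ∈ fccSlots} ⟪w,a⟫ ⟪w,b⟫ = 4 ⟪a,b⟫`. -/
theorem sum_fccSlots_inner_mul_inner (a b : EuclideanSpace ℝ (Fin 3)) :
    ∑ w ∈ fccSlots, ⟪w, a⟫_ℝ * ⟪w, b⟫_ℝ = 4 * ⟪a, b⟫_ℝ := by
  classical
  rw [fccSlots_eq_image, Finset.sum_image fun k _ l _ h => slotSite_injective h]
  simp_rw [inner_eq_cubicCoords, cubicCoords_slotSite]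
  exact sum_slotVec_dot_mul_dot _ _

/-- Vector form: `Σ_{w ∈ fccSlots} ⟪w,ν⟫ • w = 4 • ν`. -/
theorem sum_fccSlots_inner_smul (ν : EuclideanSpace ℝ (Fin 3)) :
    ∑ w ∈ fccSlots, ⟪w, ν⟫_ℝ • w = (4 : ℝ) • ν := by
  apply ext_inner_right ℝ
  intro b
  rw [sum_inner, real_inner_smul_left]
  simp_rw [real_inner_smul_left]
  rw [← sum_fccSlots_inner_mul_inner ν b]

/-- **The exact lattice flux source.** Summing `⟪w,ν⟫ w` over the bond vectors on the positive side of
`ν` gives exactly `2ν`, for every `ν`:  `Σ_{w ∈ fccSlots} max ⟪w,ν⟫ 0 • w = 2 • ν`.  (Central symmetry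
`neg_mem_fccSlots` pairs `w` with `−w`, and `⟪w,ν⟫ = max ⟪w,ν⟫ 0 − max ⟪−w,ν⟫ 0`.) -/
theorem sum_fccSlots_posPart_inner_smul (ν : EuclideanSpace ℝ (Fin 3)) :
    ∑ w ∈ fccSlots, max ⟪w, ν⟫_ℝ 0 • w = (2 : ℝ) • ν := by
  classical
  -- reindex the sum by the involution `w ↦ -w`
  have hre : ∑ w ∈ fccSlots, max ⟪-w, ν⟫_ℝ 0 • w = -∑ w ∈ fccSlots, max ⟪w, ν⟫_ℝ 0 • w := by
    rw [← Finset.sum_neg_distrib]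
    refine Finset.sum_nbij' (fun w => -w) (fun w => -w) (fun w hw => neg_mem_fccSlots hw)
      (fun w hw => neg_mem_fccSlots hw) (fun w _ => neg_neg w) (fun w _ => neg_neg w) ?_
    intro w _
    rw [smul_neg, neg_neg]
  have hsplit : ∀ w : EuclideanSpace ℝ (Fin 3),
      ⟪w, ν⟫_ℝ • w = max ⟪w, ν⟫_ℝ 0 • w - max ⟪-w, ν⟫_ℝ 0 • w := by
    intro w
    rw [← sub_smul, inner_neg_left]
    congr 1
    rcases le_total 0 ⟪w, ν⟫_ℝ with h | h
    · rw [max_eq_left h, max_eq_right (by linarith), sub_zero]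
    · rw [max_eq_right h, max_eq_left (by linarith)]; ring
  have h4 := sum_fccSlots_inner_smul ν
  simp_rw [hsplit] at h4
  rw [Finset.sum_sub_distrib, hre, sub_neg_eq_add, ← two_smul ℝ] at h4
  have h4' : (2 : ℝ) • ∑ w ∈ fccSlots, max ⟪w, ν⟫_ℝ 0 • w = (2 : ℝ) • ((2 : ℝ) • ν) := by
    rw [h4, smul_smul]; norm_num
  exact smul_right_injective _ (by norm_num : (2 : ℝ) ≠ 0) h4'

/-- Scalar form of the flux source: `Σ_{w ∈ fccSlots} max ⟪w,ν⟫ 0 · ⟪w,y⟫ = 2⟪ν,y⟫` — the bonds crossing a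
plane `⊥ ν` upwards, weighted by `⟪w,ν⟫`, carry the flux `2⟪ν,y⟫` of any constant field `y` (per site). -/
theorem sum_fccSlots_posPart_inner_mul_inner (ν y : EuclideanSpace ℝ (Fin 3)) :
    ∑ w ∈ fccSlots, max ⟪w, ν⟫_ℝ 0 * ⟪w, y⟫_ℝ = 2 * ⟪ν, y⟫_ℝ := by
  have h := congrArg (fun v => ⟪v, y⟫_ℝ) (sum_fccSlots_posPart_inner_smul ν)
  simp only [sum_inner, real_inner_smul_left] at h
  exact h

/-- In particular `Σ_{w ∈ fccSlots} (max ⟪w,ν⟫ 0)² = 2‖ν‖²`: the upward bonds through a unit-normal plane have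
total squared height `2` per site (the source density of the Voronoi flux identity, the same for every `ν`). -/
theorem sum_fccSlots_posPart_inner_sq (ν : EuclideanSpace ℝ (Fin 3)) :
    ∑ w ∈ fccSlots, (max ⟪w, ν⟫_ℝ 0) ^ 2 = 2 * ‖ν‖ ^ 2 := by
  rw [← real_inner_self_eq_norm_sq, ← sum_fccSlots_posPart_inner_mul_inner ν ν]
  refine Finset.sum_congr rfl fun w _ => ?_
  rcases le_total 0 ⟪w, ν⟫_ℝ with h | h
  · rw [max_eq_left h, sq]
  · rw [max_eq_right h]; ring

end Summit.Ventures.Crystal3D.Theorems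

end
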